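import Literature.Probability.RandomPlanarGeometry.LoewnerBoundaryExtension
import Literature.Probability.RandomPlanarGeometry.SLERealFlowIto
import Literature.Probability.RandomPlanarGeometry.LoewnerDerivRatio
import Literature.Probability.RandomPlanarGeometry.LoewnerHullHitting
import Literature.Probability.RandomPlanarGeometry.PlusHullKoebe
import Literature.Analysis.Complex.RiemannMapping
import Literature.Analysis.Complex.InjectiveHolomorphic
import HarnessLib

/-!
# Koebe's one-quarter theorem at an unswallowed real point of a Loewner chain

Trunk T-STOCH, deterministic Loewner theory. S. Rohde, O. Schramm, *Basic properties of SLE*,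
Ann. of Math. 161 (2005), proof of Lemma 7.2, case `κ = 4` (p. 909):

> "Let `0 < y < x < ∞`. Let `γ̄(t)` denote the complex conjugate of `γ(t)`, and set
> `D_t := ℂ ∖ (γ[0,t] ∪ γ̄[0,t] ∪ (-∞, y])`. Using Schwarz reflection, `g_t` may be conformally
> extended to `D_t`. Note that `g_t(D_t) = ℂ ∖ (-∞, g_t(y)]`. By the Koebe 1/4 Theorem applied
> to `g_t⁻¹`, the distance from `x` to `∂D_t` is at least `¼ (g_t(x) - g_t(y)) / g_t'(x)`."

We **prove** this for the chordal Loewner chain of an arbitrary continuous driving function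
`W` and real points `W 0 < y < x` with `t < T_y` (no curve is needed; "Schwarz reflection" is
replaced by the conjugation symmetry of the Loewner ODE, under which the Loewner map `g_t`,
defined on all of `ℂ` by the flow, is already holomorphic and injective on the two-sided
domain):

* `Loewner.swallowingTime_conj`, `Loewner.map_conj` — the flow commutes with complex
  conjugation (`W` is real; `Loewner.isSolution_conj` of `LoewnerDerivRatio`);
* `Loewner.realKoebeDomain W t y = {z | t < T_z, and y < re z if z is real}` is open, `g_t` is
  holomorphic and injective on it, and maps it ONTO `{w | g_t(y) < re w if w is real}
  = ℂ ∖ (-∞, g_t(y)]` (`Loewner.image_map_realKoebeDomain`);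
* `Loewner.ball_ofReal_subset_realKoebeDomain` — **Koebe**: for `y < x`,
  `B(x, (g_t(x) - g_t(y)) / (4 |g_t'(x)|)) ⊆ realKoebeDomain W t y` (Koebe's one-quarter
  theorem of the tree, `Literature.Analysis.Complex.koebeQuarter_holds` through
  `ball_subset_image_of_injOn_ball`, applied to the
  holomorphic inverse `Complex.hasStrictDerivAt_invFunOn` on the disc
  `B(g_t(x), g_t(x) - g_t(y))`);
* consequences: that ball misses the hull `K_t` (`Loewner.le_dist_ofReal_of_mem_hull`) and, for
  a chain generated by a curve, the curve `γ[0, t]` (`Loewner.IsGeneratedByCurve.le_dist_apply_ofReal`);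
* the real derivative: `g_t'(x) = exp(-2 ∫₀ᵗ ds / X_s²) ∈ (0, 1]`, `X_s = g_s(x) - W_s`
  (`Loewner.deriv_map_ofReal_eq_exp`), increasing in `x` (`Loewner.norm_deriv_map_ofReal_mono`),
  and the mean-value bound `(x - y) g_t'(y) ≤ g_t(x) - g_t(y)`
  (`Loewner.sub_mul_norm_deriv_le_map_sub`), whence the form used for SLE:
  `dist(x', γ[0,t]) ≥ (x' - y') g_t'(y') / (4 g_t'(x))` for `y' < x' ≤ x`
  (`Loewner.IsGeneratedByCurve.le_dist_apply_ofReal'`).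

## References

* S. Rohde, O. Schramm, *Basic properties of SLE*, Ann. of Math. 161 (2005), proof of
  Lemma 7.2 (p. 909).
* G. F. Lawler, *Conformally Invariant Processes in the Plane*, AMS (2005), Thm. 3.17 (Koebe
  1/4), §4.1 (the chordal Loewner flow, real points).
* J. B. Conway, *Functions of One Complex Variable* (1978), IV.7.6 (holomorphic inverse).
-/

noncomputable section

open Set Filter Topology Metric Complex Function
open UpperHalfPlane (upperHalfPlaneSet isOpen_upperHalfPlaneSet)
open scoped NNReal ComplexConjugate

namespace Literature.Probability.RandomPlanarGeometry

namespace Loewner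

variable {W : ℝ≥0 → ℝ} {z : ℂ} {g : ℝ → ℂ} {T : WithTop ℝ≥0}

/-! ### Conjugation symmetry of the flow (continued from `LoewnerDerivRatio`) -/

/-- The swallowing time is invariant under conjugation: `T_{z̄} = T_z`. [folklore] -/
theorem swallowingTime_conj (W : ℝ≥0 → ℝ) (z : ℂ) :
    swallowingTime W (conj z) = swallowingTime W z := by
  apply le_antisymm
  · refine sSup_le fun T ⟨g, hg⟩ ↦ le_sSup ⟨fun t ↦ conj (g t), ?_⟩
    have := isSolution_conj hg
    simp only [Complex.conj_conj] at this
    exact this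
  · exact sSup_le fun T ⟨g, hg⟩ ↦ le_sSup ⟨fun t ↦ conj (g t), isSolution_conj hg⟩

/-- **`g_t(z̄) = conj (g_t z)`** for `t < T_z` (continuous driving function).
[cite: Lawler2005, Ch. 4 §4.1] -/
theorem map_conj (hW : Continuous W) {t : ℝ≥0} (ht : (t : WithTop ℝ≥0) < swallowingTime W z) :
    map W t (conj z) = conj (map W t z) := by
  have hz : z ≠ W 0 := ne_driving_of_lt_swallowingTime ht
  obtain ⟨g, hg⟩ := exists_isSolution_swallowingTime_holds hW hz
  have ht' : (t : WithTop ℝ≥0) < swallowingTime W (conj z) := by rwa [swallowingTime_conj]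
  rw [map_eq_of_isSolution hW hg ht]
  have hg' : IsSolution W (conj z) (fun t ↦ conj (g t)) (swallowingTime W (conj z)) := by
    rw [swallowingTime_conj]; exact isSolution_conj hg
  rw [map_eq_of_isSolution hW hg' ht']

/-! ### Real points move to the right of themselves -/

/-- **`x ≤ g_t(x)` for a real point `x > W 0` not yet swallowed**: by the integrated equation
`g_t(x) - W_t = x - W_t + ∫₀ᵗ 2 ds/(g_s(x) - W_s)` (`realFlow_eq_sub_add_integral`) with a
positive integrand (`realFlow_pos`). Lawler (2005), §4.1. [cite: Lawler2005, Ch. 4 §4.1] -/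
theorem self_le_map_ofReal_re (hW : Continuous W) {x : ℝ} (hx : W 0 < x) {t : ℝ≥0}
    (ht : (t : WithTop ℝ≥0) < swallowingTime W x) : x ≤ (map W t x).re := by
  have h := realFlow_eq_sub_add_integral hW hx.ne' ht
  rw [realFlow_apply] at h
  have hint : 0 ≤ ∫ s in (0 : ℝ)..t, 2 / realFlow W x s.toNNReal := by
    refine intervalIntegral.integral_nonneg t.coe_nonneg fun s hs ↦ ?_
    have hsT : ((s.toNNReal : ℝ≥0) : WithTop ℝ≥0) < swallowingTime W x := by
      refine lt_of_le_of_lt ?_ ht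
      exact WithTop.coe_le_coe.2 (Real.toNNReal_le_iff_le_coe.2 hs.2)
    exact div_nonneg zero_le_two (realFlow_pos hW hx hsT).le
  linarith


/-! ### The two-sided domain of `g_t` to the right of a real point -/

/-- The **two-sided Koebe domain** of the Loewner map at time `t` relative to the real point
`y`: the points still flowing at time `t`, the real ones among them being restricted to
`(y, ∞)`. For `W 0 < y` and `t < T_y` this is `H_t ∪ conj H_t ∪ (y, ∞)`, the domain of the
Schwarz reflection of `g_t` across `(y, ∞)` in Rohde–Schramm (2005), proof of Lemma 7.2
(`D_t ∖` its slit). [cite: RohdeSchramm2005, proof of Lemma 7.2 (p. 909)] -/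
def realKoebeDomain (W : ℝ≥0 → ℝ) (t : ℝ≥0) (y : ℝ) : Set ℂ :=
  {z : ℂ | (t : WithTop ℝ≥0) < swallowingTime W z ∧ (z.im = 0 → y < z.re)}

/-- Unfolding of `realKoebeDomain`. [folklore] -/
theorem mem_realKoebeDomain_iff {t : ℝ≥0} {y : ℝ} :
    z ∈ realKoebeDomain W t y ↔ (t : WithTop ℝ≥0) < swallowingTime W z ∧ (z.im = 0 → y < z.re) :=
  Iff.rfl

/-- The two-sided Koebe domain is open (continuous driving function). [folklore] -/
theorem isOpen_realKoebeDomain (hW : Continuous W) (t : ℝ≥0) (y : ℝ) :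
    IsOpen (realKoebeDomain W t y) := by
  have h : {z : ℂ | z.im = 0 → y < z.re} = {z : ℂ | z.im ≠ 0} ∪ {z : ℂ | y < z.re} := by
    ext z
    simp only [mem_setOf_eq, mem_union, imp_iff_not_or]
  have ho : IsOpen {z : ℂ | z.im = 0 → y < z.re} := by
    rw [h]
    exact (isOpen_ne_fun Complex.continuous_im continuous_const).union
      (isOpen_lt continuous_const Complex.continuous_re)
  exact (isOpen_setOf_lt_swallowingTime hW t).inter ho

/-- `g_t` is holomorphic on the two-sided Koebe domain. [folklore] -/
theorem differentiableOn_map_realKoebeDomain (hW : Continuous W) (t : ℝ≥0) (y : ℝ) :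
    DifferentiableOn ℂ (map W t) (realKoebeDomain W t y) :=
  (differentiableOn_map_of_lt_swallowingTime hW t).mono fun _ hz ↦ hz.1

/-- Points of `H_t` belong to the two-sided Koebe domain. [folklore] -/
theorem mem_realKoebeDomain_of_mem_domain {t : ℝ≥0} {y : ℝ} (hz : z ∈ domain W t) :
    z ∈ realKoebeDomain W t y := by
  rw [mem_domain_iff] at hz
  exact ⟨hz.2, fun h0 ↦ absurd h0 (ne_of_gt hz.1)⟩

/-- Conjugates of points of `H_t` belong to the two-sided Koebe domain. [folklore] -/
theorem conj_mem_realKoebeDomain_of_mem_domain {t : ℝ≥0} {y : ℝ} (hz : z ∈ domain W t) :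
    conj z ∈ realKoebeDomain W t y := by
  rw [mem_domain_iff] at hz
  refine ⟨by rw [swallowingTime_conj]; exact hz.2, fun h0 ↦ ?_⟩
  rw [Complex.conj_im, neg_eq_zero] at h0
  exact absurd h0 (ne_of_gt hz.1)

section Domain

variable (hW : Continuous W) {y : ℝ} (hy : W 0 < y) {t : ℝ≥0}
  (ht : (t : WithTop ℝ≥0) < swallowingTime W y)
include hW hy ht

/-- Real points right of `y` are alive as long as `y` is. [folklore] -/
theorem lt_swallowingTime_ofReal_of_le {x : ℝ} (hx : y ≤ x) :
    (t : WithTop ℝ≥0) < swallowingTime W x :=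
  lt_of_lt_of_le ht (swallowingTime_mono_right hW hy hx)

/-- Real points right of `y` belong to the two-sided Koebe domain. [folklore] -/
theorem ofReal_mem_realKoebeDomain {x : ℝ} (hx : y < x) : (x : ℂ) ∈ realKoebeDomain W t y :=
  ⟨lt_swallowingTime_ofReal_of_le hW hy ht hx.le, fun _ ↦ by simpa using hx⟩

omit hW hy ht in
/-- Trichotomy on the two-sided Koebe domain: a point is in `H_t`, or is the conjugate of a
point of `H_t`, or is a real point of `(y, ∞)`. [folklore] -/
theorem mem_realKoebeDomain_cases (hz : z ∈ realKoebeDomain W t y) :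
    z ∈ domain W t ∨ (conj z ∈ domain W t ∧ z.im < 0) ∨ (z.im = 0 ∧ y < z.re) := by
  rcases lt_trichotomy 0 z.im with him | him | him
  · exact Or.inl ((mem_domain_iff W t z).2 ⟨him, hz.1⟩)
  · exact Or.inr (Or.inr ⟨him.symm, hz.2 him.symm⟩)
  · refine Or.inr (Or.inl ⟨(mem_domain_iff W t _).2 ⟨?_, ?_⟩, him⟩)
    · show 0 < (conj z).im
      rw [Complex.conj_im]
      linarith
    · rw [swallowingTime_conj]
      exact hz.1

/-- On real points of the domain, `g_t` is real and lies to the right of `g_t(y)`. [folklore] -/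
theorem map_re_of_real (hz : z ∈ realKoebeDomain W t y) (him : z.im = 0) :
    map W t z = (((map W t z).re : ℝ) : ℂ) ∧ (map W t y).re < (map W t z).re := by
  have hzre : z = ((z.re : ℝ) : ℂ) := Complex.ext (by simp) (by simp [him])
  have hyz : y < z.re := hz.2 him
  have htz : (t : WithTop ℝ≥0) < swallowingTime W (z.re : ℝ) :=
    lt_swallowingTime_ofReal_of_le hW hy ht hyz.le
  rw [hzre]
  exact ⟨map_ofReal_eq hW htz, map_ofReal_re_lt_of_lt hW hy hyz ht htz⟩

omit hy ht in
/-- On conjugates of points of `H_t`, `g_t` takes values in the lower half-plane. [folklore] -/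
theorem map_im_neg_of_conj_mem (hz : conj z ∈ domain W t) : (map W t z).im < 0 := by
  have h1 : map W t z = conj (map W t (conj z)) := by
    have := map_conj hW (z := conj z) (t := t) ((mem_domain_iff W t _).1 hz).2
    rw [Complex.conj_conj] at this
    exact this
  rw [h1, Complex.conj_im, neg_lt_zero]
  exact im_map_pos hW hz

/-- **`g_t` is injective on the two-sided Koebe domain**: it maps `H_t` into `ℍₒ`, the
conjugates into the lower half-plane and `(y, ∞)` increasingly into `ℝ`, and is injective on
each piece (`injOn_map`, conjugation, `map_ofReal_re_lt_of_lt`). [folklore] -/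
theorem injOn_map_realKoebeDomain : InjOn (map W t) (realKoebeDomain W t y) := by
  intro z₁ hz₁ z₂ hz₂ heq
  rcases mem_realKoebeDomain_cases hz₁ with h₁ | ⟨h₁, him₁⟩ | ⟨him₁, hre₁⟩ <;>
    rcases mem_realKoebeDomain_cases hz₂ with h₂ | ⟨h₂, him₂⟩ | ⟨him₂, hre₂⟩
  · exact injOn_map hW t h₁ h₂ heq
  · exfalso
    have := im_map_pos hW h₁
    rw [heq] at this
    linarith [map_im_neg_of_conj_mem hW h₂]
  · exfalso
    have h := im_map_pos hW h₁
    rw [heq, (map_re_of_real hW hy ht hz₂ him₂).1, Complex.ofReal_im] at h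
    exact lt_irrefl _ h
  · exfalso
    have := im_map_pos hW h₂
    rw [← heq] at this
    linarith [map_im_neg_of_conj_mem hW h₁]
  · have h := injOn_map hW t h₁ h₂ (by rw [map_conj hW hz₁.1, map_conj hW hz₂.1, heq])
    exact (starRingEnd ℂ).injective h
  · exfalso
    have h := map_im_neg_of_conj_mem hW h₁
    rw [heq, (map_re_of_real hW hy ht hz₂ him₂).1, Complex.ofReal_im] at h
    exact lt_irrefl _ h
  · exfalso
    have h := im_map_pos hW h₂
    rw [← heq, (map_re_of_real hW hy ht hz₁ him₁).1, Complex.ofReal_im] at h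
    exact lt_irrefl _ h
  · exfalso
    have h := map_im_neg_of_conj_mem hW h₂
    rw [← heq, (map_re_of_real hW hy ht hz₁ him₁).1, Complex.ofReal_im] at h
    exact lt_irrefl _ h
  · -- two real points right of `y`: strict monotonicity
    have hz₁re : z₁ = ((z₁.re : ℝ) : ℂ) := Complex.ext (by simp) (by simp [him₁])
    have hz₂re : z₂ = ((z₂.re : ℝ) : ℂ) := Complex.ext (by simp) (by simp [him₂])
    have ht₁ := lt_swallowingTime_ofReal_of_le hW hy ht hre₁.le
    have ht₂ := lt_swallowingTime_ofReal_of_le hW hy ht hre₂.le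
    rcases lt_trichotomy z₁.re z₂.re with hlt | he | hlt
    · exfalso
      have h := map_ofReal_re_lt_of_lt hW (hy.trans hre₁) hlt ht₁ ht₂
      rw [← hz₁re, ← hz₂re, heq] at h
      exact lt_irrefl _ h
    · rw [hz₁re, hz₂re, he]
    · exfalso
      have h := map_ofReal_re_lt_of_lt hW (hy.trans hre₂) hlt ht₂ ht₁
      rw [← hz₁re, ← hz₂re, heq] at h
      exact lt_irrefl _ h

/-- **The image of the two-sided Koebe domain is the slit plane `ℂ ∖ (-∞, g_t(y)]`**, i.e.
`{w | re w > g_t(y) if w is real}`: `H_t ↦ ℍₒ` onto (`bijOn_map`), conjugates onto the lower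
half-plane, and `(y, ∞) ↦ (g_t(y), ∞)` onto (intermediate values, using `x ≤ g_t(x)`).
Rohde–Schramm (2005), proof of Lemma 7.2: "`g_t(D_t) = ℂ ∖ (-∞, g_t(y)]`".
[cite: RohdeSchramm2005, proof of Lemma 7.2 (p. 909)] -/
theorem image_map_realKoebeDomain :
    map W t '' realKoebeDomain W t y = {w : ℂ | w.im = 0 → (map W t y).re < w.re} := by
  apply Subset.antisymm
  · rintro _ ⟨z, hz, rfl⟩ him
    rcases mem_realKoebeDomain_cases hz with h | ⟨h, -⟩ | ⟨hzim, -⟩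
    · exact absurd him (ne_of_gt (im_map_pos hW h))
    · exact absurd him (ne_of_lt (map_im_neg_of_conj_mem hW h))
    · exact (map_re_of_real hW hy ht hz hzim).2
  · intro w hw
    rcases lt_trichotomy 0 w.im with him | him | him
    · -- upper half-plane: `w = g_t (f_t w)`
      exact ⟨loewnerInv W t w, mem_realKoebeDomain_of_mem_domain (loewnerInv_mem_domain hW t him),
        map_loewnerInv hW t him⟩
    · -- real point right of `g_t(y)`: intermediate value theorem on `[y, re w]`
      have hr : (map W t y).re < w.re := hw him.symm
      have hyr : y < w.re := lt_of_le_of_lt (self_le_map_ofReal_re hW hy ht) hr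
      set φ : ℝ → ℝ := fun u ↦ (map W t u).re with hφ
      have hφc : ContinuousOn φ (Icc y w.re) := by
        intro u hu
        have htu := lt_swallowingTime_ofReal_of_le hW hy ht hu.1
        exact (Complex.continuous_re.continuousAt.comp ((continuousAt_map hW htu).comp
          Complex.continuous_ofReal.continuousAt)).continuousWithinAt
      have hmem : w.re ∈ Icc (φ y) (φ w.re) :=
        ⟨hr.le, self_le_map_ofReal_re hW (hy.trans hyr) (lt_swallowingTime_ofReal_of_le hW hy ht hyr.le)⟩
      obtain ⟨x, hx, hxw⟩ := intermediate_value_Icc hyr.le hφc hmem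
      have hxy : y < x := by
        rcases eq_or_lt_of_le hx.1 with h | h
        · exfalso
          rw [← h] at hxw
          exact absurd hxw (ne_of_lt hr)
        · exact h
      refine ⟨x, ofReal_mem_realKoebeDomain hW hy ht hxy, ?_⟩
      rw [map_ofReal_eq hW (lt_swallowingTime_ofReal_of_le hW hy ht hx.1)]
      exact Complex.ext (by simpa [hφ] using hxw) (by simp [him.symm])
    · -- lower half-plane: conjugate
      have him' : 0 < (conj w).im := by rw [Complex.conj_im]; linarith
      refine ⟨conj (loewnerInv W t (conj w)),
        conj_mem_realKoebeDomain_of_mem_domain (loewnerInv_mem_domain hW t him'), ?_⟩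
      rw [map_conj hW (lt_swallowingTime_loewnerInv hW t him'), map_loewnerInv hW t him',
        Complex.conj_conj]

end Domain


/-! ### Koebe's one-quarter theorem at a real point -/

section Koebe

variable (hW : Continuous W) {y : ℝ} (hy : W 0 < y) {t : ℝ≥0}
  (ht : (t : WithTop ℝ≥0) < swallowingTime W y)
include hW hy ht

/-- `g_t'` does not vanish on the two-sided Koebe domain (injective holomorphic maps have
zero-free derivative, `SCV.deriv_ne_zero_of_injOn`). [folklore] -/
theorem deriv_map_ne_zero_of_mem_realKoebeDomain (hz : z ∈ realKoebeDomain W t y) :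
    deriv (map W t) z ≠ 0 :=
  Literature.Analysis.Complex.SCV.deriv_ne_zero_of_injOn (differentiableOn_map_realKoebeDomain hW t y)
    (isOpen_realKoebeDomain hW t y) (injOn_map_realKoebeDomain hW hy ht) hz

/-- **Koebe at a real point** (Rohde–Schramm (2005), proof of Lemma 7.2, p. 909: "By the Koebe
1/4 Theorem applied to `g_t⁻¹`, the distance from `x` to `∂D_t` is at least
`¼ (g_t(x) - g_t(y)) / g_t'(x)`"): for `W 0 < y < x` and `t < T_y`, the disc about `x` of
radius `(g_t(x) - g_t(y)) / (4 |g_t'(x)|)` is contained in the two-sided Koebe domain. Proof: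
the inverse `F` of `g_t` on the slit plane `g_t(U) = ℂ ∖ (-∞, g_t(y)]` (holomorphic,
`Complex.hasStrictDerivAt_invFunOn`) is univalent on the disc `B(g_t(x), g_t(x) - g_t(y))`,
with `F(g_t x) = x` and `F'(g_t x) = 1/g_t'(x)`; apply the tree's rescaled Koebe theorem
`ball_subset_image_of_injOn_ball` (`PlusHullKoebe`).
[cite: RohdeSchramm2005, proof of Lemma 7.2 (p. 909)] -/
theorem ball_ofReal_subset_realKoebeDomain {x : ℝ} (hx : y < x) :
    ball (x : ℂ) (((map W t x).re - (map W t y).re) / (4 * ‖deriv (map W t) x‖)) ⊆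
      realKoebeDomain W t y := by
  set U : Set ℂ := realKoebeDomain W t y with hU
  have hUo : IsOpen U := isOpen_realKoebeDomain hW t y
  have hGd : DifferentiableOn ℂ (map W t) U := differentiableOn_map_realKoebeDomain hW t y
  have hGinj : InjOn (map W t) U := injOn_map_realKoebeDomain hW hy ht
  have hG' : ∀ z ∈ U, deriv (map W t) z ≠ 0 := fun z hz ↦
    deriv_map_ne_zero_of_mem_realKoebeDomain hW hy ht hz
  have hxU : (x : ℂ) ∈ U := ofReal_mem_realKoebeDomain hW hy ht hx
  have htx : (t : WithTop ℝ≥0) < swallowingTime W x := lt_swallowingTime_ofReal_of_le hW hy ht hx.le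
  set R : ℝ := (map W t x).re - (map W t y).re with hR
  have hRpos : 0 < R := sub_pos.2 (map_ofReal_re_lt_of_lt hW hy hx ht htx)
  have hg0 : ‖deriv (map W t) x‖ ≠ 0 := norm_ne_zero_iff.2 (hG' _ hxU)
  have hg0' : 0 < ‖deriv (map W t) x‖ := (norm_nonneg _).lt_of_ne' hg0
  -- the disc `B(g_t x, R)` lies in the image `ℂ ∖ (-∞, g_t(y)]`
  have hball : ball (map W t x) R ⊆ map W t '' U := by
    rw [image_map_realKoebeDomain hW hy ht]
    intro w hw him
    rw [mem_ball, dist_eq_norm] at hw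
    have h1 : |w.re - (map W t x).re| < R :=
      calc |w.re - (map W t x).re| = |(w - map W t x).re| := by simp
        _ ≤ ‖w - map W t x‖ := Complex.abs_re_le_norm _
        _ < R := hw
    rw [abs_sub_lt_iff] at h1
    show (map W t y).re < w.re
    linarith [h1.1, h1.2]
  -- the inverse on the disc
  set F : ℂ → ℂ := invFunOn (map W t) U with hF
  have hFd : DifferentiableOn ℂ F (ball (map W t x) R) :=
    (Complex.differentiableOn_invFunOn_image hUo hGd hGinj hG').mono hball
  have hFinj : InjOn F (ball (map W t x) R) := fun w₁ h₁ w₂ h₂ heq ↦ by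
    have e₁ : map W t (F w₁) = w₁ := invFunOn_eq (hball h₁)
    have e₂ : map W t (F w₂) = w₂ := invFunOn_eq (hball h₂)
    rw [← e₁, ← e₂, heq]
  have hK := ball_subset_image_of_injOn_ball hRpos hFd hFinj
  have hFx : F (map W t x) = x := hGinj.leftInvOn_invFunOn hxU
  have hF' : deriv F (map W t x) = (deriv (map W t) x)⁻¹ :=
    (Complex.hasStrictDerivAt_invFunOn hUo hGd hGinj hG' hxU).hasDerivAt.deriv
  rw [hFx, hF', norm_inv] at hK
  have hrad : R / (4 * ‖deriv (map W t) x‖) = R * ‖deriv (map W t) x‖⁻¹ / 4 := by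
    field_simp
  rw [hrad]
  refine hK.trans ?_
  rintro _ ⟨w, hw, rfl⟩
  exact invFunOn_mem (hball hw)

/-- **The hull stays away from `x`**: every point of `K_t` is at distance at least
`(g_t(x) - g_t(y)) / (4 |g_t'(x)|)` from `x` (points of the hull are swallowed by time `t`,
points of the Koebe disc are not). [cite: RohdeSchramm2005, proof of Lemma 7.2 (p. 909)] -/
theorem le_dist_ofReal_of_mem_hull {x : ℝ} (hx : y < x) {w : ℂ} (hw : w ∈ hull W t) :
    ((map W t x).re - (map W t y).re) / (4 * ‖deriv (map W t) x‖) ≤ dist w x := by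
  by_contra hlt
  rw [not_le] at hlt
  have hU := ball_ofReal_subset_realKoebeDomain hW hy ht hx (mem_ball.2 hlt)
  exact absurd hU.1 (not_lt.2 hw.2)

/-- **The generating curve stays away from `x`** (Rohde–Schramm (2005), proof of Lemma 7.2:
"the distance from `x` to `∂D_t` is at least `¼ (g_t(x) - g_t(y))/g_t'(x)`"): for a chain
generated by `γ`, every `γ(s)`, `s ≤ t`, is at distance at least
`(g_t(x) - g_t(y)) / (4 |g_t'(x)|)` from `x`. (The curve lies in the closure of the hull,
`image_Icc_subset_closure_hull`, which misses the open Koebe domain.)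
[cite: RohdeSchramm2005, proof of Lemma 7.2 (p. 909)] -/
theorem IsGeneratedByCurve.le_dist_apply_ofReal {γ : ℝ≥0 → ℂ} (hγ : IsGeneratedByCurve W γ)
    {x : ℝ} (hx : y < x) {s : ℝ≥0} (hs : s ≤ t) :
    ((map W t x).re - (map W t y).re) / (4 * ‖deriv (map W t) x‖) ≤ dist (γ s) x := by
  by_contra hlt
  rw [not_le] at hlt
  have hU := ball_ofReal_subset_realKoebeDomain hW hy ht hx (mem_ball.2 hlt)
  rcases (show (0 : ℝ≥0) ≤ t from bot_le).eq_or_lt with ht0 | ht0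
  · -- `t = 0`: `γ 0 = W 0` is real and left of `y`
    have hs0 : s = 0 := le_antisymm (ht0 ▸ hs) bot_le
    rw [hs0, hγ.apply_zero] at hU
    have := hU.2 (Complex.ofReal_im _)
    rw [Complex.ofReal_re] at this
    linarith
  · have hcl : γ s ∈ closure (hull W t) :=
      hγ.image_Icc_subset_closure_hull hW ht0 ⟨s, ⟨bot_le, hs⟩, rfl⟩
    have hsub : closure (hull W t) ⊆ (realKoebeDomain W t y)ᶜ :=
      closure_minimal (fun w hw hU' ↦ absurd hU'.1 (not_lt.2 hw.2))
        (isOpen_realKoebeDomain hW t y).isClosed_compl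
    exact hsub hcl hU

end Koebe


/-! ### The derivative of `g_t` at real points -/

section RealDeriv

variable (hW : Continuous W)
include hW

/-- Along the solution from a real point `x > W 0`: the real flow `X_s = re g_s(x) - W_s` is
the value `g s - W s` (which is real), is positive, and is continuous on `[0, t]`. [folklore] -/
theorem IsSolution.sub_driving_eq_ofReal_realFlow {x : ℝ} (hg : IsSolution W x g (swallowingTime W x))
    {s : ℝ} (hs0 : 0 ≤ s) (hs : ((s.toNNReal : ℝ≥0) : WithTop ℝ≥0) < swallowingTime W x) :
    g s - (W s.toNNReal : ℂ) = ((realFlow W x s.toNNReal : ℝ) : ℂ) := by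
  have him : (g s).im = 0 := IsSolution.im_eq_zero_holds hg (Complex.ofReal_im x) s hs0 hs
  rw [realFlow_eq_re_sub hW hg hs, Real.coe_toNNReal _ hs0]
  exact Complex.ext (by simp) (by simp [him])

/-- **`log |g_t'(x)| = -2 ∫₀ᵗ ds / X_s²`** for a real point `x > W 0` alive at time `t`
(`X_s = re g_s(x) - W_s` the real flow): the integrated form of `∂_t log g_t'(x) = -2/(g_t(x) - W_t)²`
(Rohde–Schramm (2005), eq. (3.3), at a real point; `hasDerivAt_map`, `norm_deriv_map_eq`).
[cite: RohdeSchramm2005, eq. (3.3)] -/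
theorem log_norm_deriv_map_ofReal {x : ℝ} (hx : W 0 < x) {t : ℝ≥0}
    (ht : (t : WithTop ℝ≥0) < swallowingTime W x) :
    Real.log ‖deriv (map W t) x‖ = ∫ s in (0 : ℝ)..t, -2 / (realFlow W x s.toNNReal) ^ 2 := by
  have hx' : (x : ℂ) ≠ W 0 := fun h ↦ hx.ne' (by exact_mod_cast h)
  obtain ⟨g, hg⟩ := exists_isSolution_swallowingTime_holds hW hx'
  have htT := toNNReal_coe_lt ht
  have hsub := Icc_subset_timeDomain (T := swallowingTime W x) htT
  rw [norm_deriv_map_eq hW ht hg, Real.log_exp]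
  refine intervalIntegral.integral_congr fun s hs ↦ ?_
  rw [uIcc_of_le t.coe_nonneg] at hs
  have h1 := hg.sub_driving_eq_ofReal_realFlow hW hs.1 (hsub hs).2
  simp only [h1]
  rw [show (-2 : ℂ) / ((realFlow W x s.toNNReal : ℂ) * (realFlow W x s.toNNReal : ℂ)) =
    ((-2 / (realFlow W x s.toNNReal) ^ 2 : ℝ) : ℂ) by push_cast; ring, Complex.ofReal_re]

/-- `|g_t'(x)| = exp(-2 ∫₀ᵗ ds / X_s²)`; in particular `0 < |g_t'(x)| ≤ 1`. [cite: RohdeSchramm2005, eq. (3.3)] -/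
theorem norm_deriv_map_ofReal_eq_exp {x : ℝ} (hx : W 0 < x) {t : ℝ≥0}
    (ht : (t : WithTop ℝ≥0) < swallowingTime W x) :
    ‖deriv (map W t) x‖ = Real.exp (∫ s in (0 : ℝ)..t, -2 / (realFlow W x s.toNNReal) ^ 2) := by
  have hx' : (x : ℂ) ≠ W 0 := fun h ↦ hx.ne' (by exact_mod_cast h)
  obtain ⟨g, hg⟩ := exists_isSolution_swallowingTime_holds hW hx'
  have hpos : 0 < ‖deriv (map W t) x‖ := by
    rw [norm_deriv_map_eq hW ht hg]; exact Real.exp_pos _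
  rw [← log_norm_deriv_map_ofReal hW hx ht, Real.exp_log hpos]

/-- `0 < |g_t'(x)|` at a real point alive at time `t`. [folklore] -/
theorem norm_deriv_map_ofReal_pos {x : ℝ} (hx : W 0 < x) {t : ℝ≥0}
    (ht : (t : WithTop ℝ≥0) < swallowingTime W x) : 0 < ‖deriv (map W t) x‖ := by
  rw [norm_deriv_map_ofReal_eq_exp hW hx ht]; exact Real.exp_pos _

/-- `|g_t'(x)| ≤ 1` at a real point alive at time `t`. [folklore] -/
theorem norm_deriv_map_ofReal_le_one {x : ℝ} (hx : W 0 < x) {t : ℝ≥0}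
    (ht : (t : WithTop ℝ≥0) < swallowingTime W x) : ‖deriv (map W t) x‖ ≤ 1 := by
  rw [norm_deriv_map_ofReal_eq_exp hW hx ht]
  have h : 0 ≤ ∫ s in (0 : ℝ)..t, -(-2 / (realFlow W x s.toNNReal) ^ 2) :=
    intervalIntegral.integral_nonneg t.coe_nonneg fun s _ ↦ by
      rw [neg_div, neg_neg]; positivity
  rw [intervalIntegral.integral_neg] at h
  exact Real.exp_le_one_iff.2 (by linarith)

/-- The real flow is continuous in time on `[0, t]` for `t < T_x` (real `x > W 0`). [folklore] -/
theorem continuousOn_realFlow_toNNReal {x : ℝ} (hx : W 0 < x) {t : ℝ≥0}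
    (ht : (t : WithTop ℝ≥0) < swallowingTime W x) :
    ContinuousOn (fun s : ℝ ↦ realFlow W x s.toNNReal) (Icc 0 t) := by
  have hx' : (x : ℂ) ≠ W 0 := fun h ↦ hx.ne' (by exact_mod_cast h)
  obtain ⟨g, hg⟩ := exists_isSolution_swallowingTime_holds hW hx'
  have htT := toNNReal_coe_lt ht
  have hsub := Icc_subset_timeDomain (T := swallowingTime W x) htT
  have hc : ContinuousOn (fun s : ℝ ↦ (g s).re - W s.toNNReal) (Icc 0 t) :=
    (Complex.continuous_re.comp_continuousOn (hg.continuousOn.mono hsub)).sub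
      (hW.comp continuous_real_toNNReal).continuousOn
  refine hc.congr fun s hs ↦ ?_
  have h1 := hg.sub_driving_eq_ofReal_realFlow hW hs.1 (hsub hs).2
  have := congrArg Complex.re h1
  simpa using this.symm

/-- The real flow is monotone in the starting point: `W 0 < y ≤ x ⇒ Y_s ≤ X_s` (`s < T_y`).
[folklore] -/
theorem realFlow_mono_right {x y : ℝ} (hy : W 0 < y) (hyx : y ≤ x) {s : ℝ≥0}
    (hs : (s : WithTop ℝ≥0) < swallowingTime W y) : realFlow W y s ≤ realFlow W x s := by
  rcases eq_or_lt_of_le hyx with rfl | hlt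
  · exact le_rfl
  · rw [realFlow_apply, realFlow_apply]
    have hsx : (s : WithTop ℝ≥0) < swallowingTime W x :=
      lt_of_lt_of_le hs (swallowingTime_mono_right hW hy hyx)
    linarith [map_ofReal_re_lt_of_lt hW hy hlt hs hsx]

/-- **`|g_t'|` is non-decreasing along the real axis**: `W 0 < y ≤ x`, `t < T_y` ⇒
`|g_t'(y)| ≤ |g_t'(x)|` (the rates `-2/Y_s² ≤ -2/X_s²` since `0 < Y_s ≤ X_s`). [folklore] -/
theorem norm_deriv_map_ofReal_mono {x y : ℝ} (hy : W 0 < y) (hyx : y ≤ x) {t : ℝ≥0}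
    (ht : (t : WithTop ℝ≥0) < swallowingTime W y) :
    ‖deriv (map W t) y‖ ≤ ‖deriv (map W t) x‖ := by
  have hx : W 0 < x := hy.trans_le hyx
  have htx : (t : WithTop ℝ≥0) < swallowingTime W x :=
    lt_of_lt_of_le ht (swallowingTime_mono_right hW hy hyx)
  rw [norm_deriv_map_ofReal_eq_exp hW hy ht, norm_deriv_map_ofReal_eq_exp hW hx htx,
    Real.exp_le_exp]
  have hcy := continuousOn_realFlow_toNNReal hW hy ht
  have hcx := continuousOn_realFlow_toNNReal hW hx htx
  have hpos : ∀ s ∈ Icc (0 : ℝ) t, 0 < realFlow W y s.toNNReal := fun s hs ↦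
    realFlow_pos hW hy (lt_of_le_of_lt (WithTop.coe_le_coe.2 (Real.toNNReal_le_iff_le_coe.2 hs.2)) ht)
  have hposx : ∀ s ∈ Icc (0 : ℝ) t, 0 < realFlow W x s.toNNReal := fun s hs ↦
    realFlow_pos hW hx (lt_of_le_of_lt (WithTop.coe_le_coe.2 (Real.toNNReal_le_iff_le_coe.2 hs.2)) htx)
  refine intervalIntegral.integral_mono_on t.coe_nonneg ?_ ?_ fun s hs ↦ ?_
  · exact ((continuousOn_const.div (hcy.pow 2) fun s hs ↦ (pow_pos (hpos s hs) 2).ne').mono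
      (by rw [uIcc_of_le t.coe_nonneg])).intervalIntegrable
  · exact ((continuousOn_const.div (hcx.pow 2) fun s hs ↦ (pow_pos (hposx s hs) 2).ne').mono
      (by rw [uIcc_of_le t.coe_nonneg])).intervalIntegrable
  · have h1 : realFlow W y s.toNNReal ≤ realFlow W x s.toNNReal := realFlow_mono_right hW hy hyx
      (lt_of_le_of_lt (WithTop.coe_le_coe.2 (Real.toNNReal_le_iff_le_coe.2 hs.2)) ht)
    have h2 : (realFlow W y s.toNNReal) ^ 2 ≤ (realFlow W x s.toNNReal) ^ 2 :=
      pow_le_pow_left₀ (hpos s hs).le h1 2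
    rw [div_le_div_iff₀ (pow_pos (hpos s hs) 2) (pow_pos (hposx s hs) 2)]
    nlinarith

/-- **Mean-value bound `(x - y) |g_t'(y)| ≤ g_t(x) - g_t(y)`** for `W 0 < y ≤ x`, `t < T_y`:
by the two-point formula `g_t(x) - g_t(y) = (x - y) exp ∫₀ᵗ -2 ds/(X_s Y_s)`
(`IsSolution.sub_eq_mul_exp`) and `-2/Y_s² ≤ -2/(X_s Y_s)`. [cite: Lawler2005, Thm. 4.6] -/
theorem sub_mul_norm_deriv_le_map_sub {x y : ℝ} (hy : W 0 < y) (hyx : y ≤ x) {t : ℝ≥0}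
    (ht : (t : WithTop ℝ≥0) < swallowingTime W y) :
    (x - y) * ‖deriv (map W t) y‖ ≤ (map W t x).re - (map W t y).re := by
  rcases eq_or_lt_of_le hyx with rfl | hlt
  · simp
  have hx : W 0 < x := hy.trans hlt
  have htx : (t : WithTop ℝ≥0) < swallowingTime W x :=
    lt_of_lt_of_le ht (swallowingTime_mono_right hW hy hyx)
  have hx' : (x : ℂ) ≠ W 0 := fun h ↦ hx.ne' (by exact_mod_cast h)
  have hy' : (y : ℂ) ≠ W 0 := fun h ↦ hy.ne' (by exact_mod_cast h)
  obtain ⟨gx, hgx⟩ := exists_isSolution_swallowingTime_holds hW hx'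
  obtain ⟨gy, hgy⟩ := exists_isSolution_swallowingTime_holds hW hy'
  have htTx := toNNReal_coe_lt htx
  have htTy := toNNReal_coe_lt ht
  have hsubx := Icc_subset_timeDomain (T := swallowingTime W x) htTx
  have hsuby := Icc_subset_timeDomain (T := swallowingTime W y) htTy
  -- the two-point formula, read on the reals
  have h2 := hgy.sub_eq_mul_exp hW hgx t.coe_nonneg htTy htTx
  have hint : (∫ s in (0:ℝ)..t, -2 / ((gx s - W s.toNNReal) * (gy s - W s.toNNReal))) =
      ((∫ s in (0:ℝ)..t, -2 / (realFlow W x s.toNNReal * realFlow W y s.toNNReal) : ℝ) : ℂ) := by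
    rw [← intervalIntegral.integral_ofReal]
    refine intervalIntegral.integral_congr fun s hs ↦ ?_
    rw [uIcc_of_le t.coe_nonneg] at hs
    rw [hgx.sub_driving_eq_ofReal_realFlow hW hs.1 (hsubx hs).2,
      hgy.sub_driving_eq_ofReal_realFlow hW hs.1 (hsuby hs).2]
    push_cast
    ring
  have hdiff : (map W t x).re - (map W t y).re =
      (x - y) * Real.exp (∫ s in (0:ℝ)..t, -2 / (realFlow W x s.toNNReal * realFlow W y s.toNNReal)) := by
    rw [map_eq_of_isSolution hW hgx htx, map_eq_of_isSolution hW hgy ht]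
    have := congrArg Complex.re h2
    rw [hint, Complex.sub_re] at this
    rw [this, ← Complex.ofReal_exp, ← Complex.ofReal_sub, ← Complex.ofReal_mul, Complex.ofReal_re]
  rw [hdiff, norm_deriv_map_ofReal_eq_exp hW hy ht]
  refine mul_le_mul_of_nonneg_left (Real.exp_le_exp.2 ?_) (sub_nonneg.2 hyx)
  -- compare the rates
  have hcy := continuousOn_realFlow_toNNReal hW hy ht
  have hcx := continuousOn_realFlow_toNNReal hW hx htx
  have hpos : ∀ s ∈ Icc (0 : ℝ) t, 0 < realFlow W y s.toNNReal := fun s hs ↦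
    realFlow_pos hW hy (lt_of_le_of_lt (WithTop.coe_le_coe.2 (Real.toNNReal_le_iff_le_coe.2 hs.2)) ht)
  have hposx : ∀ s ∈ Icc (0 : ℝ) t, 0 < realFlow W x s.toNNReal := fun s hs ↦
    realFlow_pos hW hx (lt_of_le_of_lt (WithTop.coe_le_coe.2 (Real.toNNReal_le_iff_le_coe.2 hs.2)) htx)
  refine intervalIntegral.integral_mono_on t.coe_nonneg ?_ ?_ fun s hs ↦ ?_
  · exact ((continuousOn_const.div (hcy.pow 2) fun s hs ↦ (pow_pos (hpos s hs) 2).ne').mono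
      (by rw [uIcc_of_le t.coe_nonneg])).intervalIntegrable
  · exact ((continuousOn_const.div (hcx.mul hcy) fun s hs ↦
      (mul_pos (hposx s hs) (hpos s hs)).ne').mono (by rw [uIcc_of_le t.coe_nonneg])).intervalIntegrable
  · have h1 : realFlow W y s.toNNReal ≤ realFlow W x s.toNNReal := realFlow_mono_right hW hy hyx
      (lt_of_le_of_lt (WithTop.coe_le_coe.2 (Real.toNNReal_le_iff_le_coe.2 hs.2)) ht)
    rw [div_le_div_iff₀ (pow_pos (hpos s hs) 2) (mul_pos (hposx s hs) (hpos s hs))]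
    nlinarith [hpos s hs]

end RealDeriv

/-! ### The form used for SLE: distance of the curve from `x'` in terms of `g_t'(y')/g_t'(x)` -/

/-- **Distance of the curve from a real point, in terms of the derivatives of the flow**: for
`W 0 < y' < x' ≤ x`, `t < T_{y'}` and a chain generated by `γ`, every `γ(s)`, `s ≤ t`, satisfies
`dist(γ s, x') ≥ (x' - y') |g_t'(y')| / (4 |g_t'(x)|)` (Koebe bound at `x'` relative to `y'`,
`IsGeneratedByCurve.le_dist_apply_ofReal`, the mean-value bound `sub_mul_norm_deriv_le_map_sub`,
and the monotonicity `norm_deriv_map_ofReal_mono` of `|g_t'|` in the real point). This is the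
deterministic half of Rohde–Schramm's Lemma 7.2 in the form used downstream: the bound is
uniform over `x' ∈ [y' + δ, x]`. [cite: RohdeSchramm2005, proof of Lemma 7.2 (p. 909)] -/
theorem IsGeneratedByCurve.le_dist_apply_ofReal' (hW : Continuous W) {γ : ℝ≥0 → ℂ}
    (hγ : IsGeneratedByCurve W γ) {x x' y' : ℝ} (hy' : W 0 < y') (hyx' : y' < x') (hx'x : x' ≤ x)
    {t : ℝ≥0} (ht : (t : WithTop ℝ≥0) < swallowingTime W y') {s : ℝ≥0} (hs : s ≤ t) :
    (x' - y') * ‖deriv (map W t) y'‖ / (4 * ‖deriv (map W t) x‖) ≤ dist (γ s) x' := by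
  have hx' : W 0 < x' := hy'.trans hyx'
  have htx' : (t : WithTop ℝ≥0) < swallowingTime W x' :=
    lt_of_lt_of_le ht (swallowingTime_mono_right hW hy' hyx'.le)
  have h1 := hγ.le_dist_apply_ofReal hW hy' ht hyx' hs
  have h2 := sub_mul_norm_deriv_le_map_sub hW hy' hyx'.le ht
  have h3 := norm_deriv_map_ofReal_mono hW hx' hx'x htx'
  have h4 := norm_deriv_map_ofReal_pos hW hx' htx'
  calc (x' - y') * ‖deriv (map W t) y'‖ / (4 * ‖deriv (map W t) x‖)
      ≤ (x' - y') * ‖deriv (map W t) y'‖ / (4 * ‖deriv (map W t) x'‖) := by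
        apply div_le_div_of_nonneg_left _ (by positivity) (by linarith)
        exact mul_nonneg (sub_nonneg.2 hyx'.le) (norm_nonneg _)
    _ ≤ ((map W t x').re - (map W t y').re) / (4 * ‖deriv (map W t) x'‖) :=
        div_le_div_of_nonneg_right h2 (by positivity)
    _ ≤ dist (γ s) x' := h1

end Loewner

end Literature.Probability.RandomPlanarGeometry
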